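import Mathlib.Analysis.InnerProductSpace.Spectrum
import HarnessLib

/-!
# Ky Fan's minimum principle for the sum of the two smallest eigenvalues

Topic `Literature/Analysis/InnerProduct`. For a symmetric operator `T` on a real inner product
space `V` of finite dimension `m + 2 ≥ 2`, with Mathlib's (antitone) enumeration
`μ = hT.eigenvalues hd : Fin (m + 2) → ℝ` of its eigenvalues and the orthonormal eigenvector basis
`b = hT.eigenvectorBasis hd`, the two *smallest* eigenvalues are `μ (Fin.last (m+1))` and
`μ (Fin.last m).castSucc`, and

  `μ (Fin.last (m+1)) + μ (Fin.last m).castSucc = min {⟪T e₁, e₁⟫ + ⟪T e₂, e₂⟫ : e₁ ⊥ e₂ unit}`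

(Ky Fan 1949; Horn–Johnson, *Matrix Analysis*, Cor. 4.3.39 with `k = 2`). This is the identity
displayed by Huisken–Sinestrari, *Mean curvature flow with surgeries of two-convex
hypersurfaces*, Invent. Math. 175 (2009), p. 143, proof of Prop. 2.6: "`λ₁ + λ₂ =
min{W(e₁, e₁) + W(e₂, e₂) : |e₁| = |e₂| = 1, e₁ ⊥ e₂}`. This shows that `λ₁ + λ₂` is a concave
function of the Weingarten operator, being the infimum of a family of linear maps", and it is
the reason the tree states "the sum of the two smallest eigenvalues is `≥ c`" conditions in the
*Ky Fan form* "`⟪T e₁, e₁⟫ + ⟪T e₂, e₂⟫ ≥ c` for all orthonormal pairs" (e.g.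
`Literature.Geometry.Riemannian.HuiskenSinestrari2009_twoConvex_simplyConnected`,
`Matrix.TwoSmallestEigenvaluesSumGE`, `HasTwoPositiveCurvatureOperator`); here the two forms are
proved equivalent (`Literature.Analysis.InnerProduct.kyFan_two_iff`).

* `Literature.Analysis.InnerProduct.sum_mul_ge_two_smallest` — the rearrangement bound
  `Σ μᵢ cᵢ ≥ μ_L + μ_P` for antitone `μ`, `0 ≤ cᵢ ≤ 1`, `Σ cᵢ = 2`;
* `inner_apply_self_eq_sum_eigenvalues` — `⟪T u, u⟫ = Σᵢ μᵢ ⟪bᵢ, u⟫²`;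
* `kyFan_two_le` — `μ_L + μ_P ≤ ⟪T e₀, e₀⟫ + ⟪T e₁, e₁⟫` for every
  orthonormal pair (Bessel: `cᵢ = Σⱼ ⟪bᵢ, eⱼ⟫² ≤ 1`, Parseval: `Σᵢ cᵢ = 2`);
* `kyFan_two_attained` — equality for the pair of the last two eigenvectors;
* `kyFan_two_iff` — "`≥ c` for all orthonormal pairs" iff `μ_L + μ_P ≥ c`;
* `kyFan_two_superadditive` — concavity: `λ₁₂(S + T) ≥ λ₁₂(S) + λ₁₂(T)`;
* general `k` (Ky Fan 1949, Thm. 1; Harvey–Lawson Cor. 2.6): `sum_mul_ge_sum_last`, `kyFan_le`,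
  `kyFan_attained`, `kyFan_iff`, `kyFan_lt_iff` for orthonormal `k`-frames and the last `k`
  eigenvalues `{i : Fin d | d - k ≤ i}`.

Everything is proved from Mathlib's spectral theorem (`LinearMap.IsSymmetric.eigenvectorBasis`,
`apply_eigenvectorBasis`, `eigenvalues_antitone`) and Bessel's inequality
(`Orthonormal.sum_inner_products_le`). No definitions, no named facts.

## References

* Ky Fan, *On a theorem of Weyl concerning eigenvalues of linear transformations I*, Proc. Nat.
  Acad. Sci. USA 35 (1949) 652–655, Thm. 1.
* R. A. Horn, C. R. Johnson, *Matrix Analysis*, 2nd ed., CUP (2013), Cor. 4.3.39.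
* G. Huisken, C. Sinestrari, Invent. Math. 175 (2009) 137–221, p. 143. [HuiskenSinestrari2008]
-/

noncomputable section

open scoped InnerProductSpace
open Finset Module

namespace Literature.Analysis.InnerProduct

/-- **Rearrangement bound behind Ky Fan's principle (`k = 2`).** For an antitone family
`μ : Fin (m+2) → ℝ` and weights `0 ≤ cᵢ ≤ 1` with `Σ cᵢ = 2`, the weighted sum `Σ μᵢ cᵢ` is at
least the sum of the two last (smallest) entries: `Σ μᵢcᵢ - μ_L - μ_P ≥ (μ_P - μ_L)(1 - c_L) ≥ 0`
(`L = Fin.last (m+1)`, `P = (Fin.last m).castSucc`). [folklore] -/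
theorem sum_mul_ge_two_smallest {m : ℕ} {μ c : Fin (m + 2) → ℝ} (hμ : Antitone μ)
    (hc0 : ∀ i, 0 ≤ c i) (hc1 : ∀ i, c i ≤ 1) (hc2 : ∑ i, c i = 2) :
    μ (Fin.last (m + 1)) + μ (Fin.last m).castSucc ≤ ∑ i, μ i * c i := by
  set L : Fin (m + 2) := Fin.last (m + 1) with hL
  set P : Fin (m + 2) := (Fin.last m).castSucc with hP
  have hPval : (P : ℕ) = m := by simp [hP]
  have hLval : (L : ℕ) = m + 1 := by simp [hL]
  have hPL : P ≠ L := fun h => by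
    have := congrArg Fin.val h
    rw [hPval, hLval] at this
    omega
  have hPmem : P ∈ univ.erase L := mem_erase.2 ⟨hPL, mem_univ P⟩
  set R : Finset (Fin (m + 2)) := (univ.erase L).erase P with hR
  have hsplit : ∀ f : Fin (m + 2) → ℝ, ∑ i, f i = f L + f P + ∑ i ∈ R, f i := fun f => by
    rw [← Finset.add_sum_erase _ f (mem_univ L), ← Finset.add_sum_erase _ f hPmem, add_assoc]
  have hR_le : ∀ i ∈ R, μ P ≤ μ i := by
    intro i hi
    have hiP : i ≠ P := (mem_erase.1 hi).1
    have hiL : i ≠ L := (mem_erase.1 (mem_erase.1 hi).2).1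
    refine hμ (Fin.le_iff_val_le_val.2 ?_)
    have h1 : (i : ℕ) ≠ m := fun h => hiP (Fin.ext (by rw [hPval]; exact h))
    have h2 : (i : ℕ) ≠ m + 1 := fun h => hiL (Fin.ext (by rw [hLval]; exact h))
    have h3 := i.is_lt
    rw [hPval]
    omega
  have hcR : ∑ i ∈ R, c i = 2 - c L - c P := by
    have := hsplit c
    linarith
  have hbound : μ P * ∑ i ∈ R, c i ≤ ∑ i ∈ R, μ i * c i := by
    rw [Finset.mul_sum]
    exact Finset.sum_le_sum fun i hi => mul_le_mul_of_nonneg_right (hR_le i hi) (hc0 i)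
  have hPL' : μ L ≤ μ P := hμ (Fin.le_iff_val_le_val.2 (by rw [hPval, hLval]; omega))
  rw [hsplit (fun i => μ i * c i)]
  rw [hcR] at hbound
  nlinarith [hc1 L, hc0 P, hbound, hPL']

variable {V : Type*} [NormedAddCommGroup V] [InnerProductSpace ℝ V] [FiniteDimensional ℝ V]
  {T : V →ₗ[ℝ] V}

/-- **Rayleigh expansion in the eigenvector basis**: `⟪T u, u⟫ = Σᵢ μᵢ ⟪bᵢ, u⟫²` for a symmetric
`T` with orthonormal eigenvector basis `b` and eigenvalues `μ`. [folklore] -/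
theorem inner_apply_self_eq_sum_eigenvalues (hT : T.IsSymmetric) {d : ℕ} (hd : finrank ℝ V = d)
    (u : V) : ⟪T u, u⟫_ℝ =
      ∑ i, hT.eigenvalues hd i * ⟪hT.eigenvectorBasis hd i, u⟫_ℝ ^ 2 := by
  rw [hT u u, ← (hT.eigenvectorBasis hd).sum_inner_mul_inner u (T u)]
  refine Finset.sum_congr rfl fun i _ => ?_
  rw [← hT (hT.eigenvectorBasis hd i) u, hT.apply_eigenvectorBasis, real_inner_smul_left,
    real_inner_comm u]
  simp only [RCLike.ofReal_real_eq_id, id_eq]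
  ring

/-- `⟪T bᵢ, bᵢ⟫ = μᵢ` for the eigenvector basis. [folklore] -/
theorem inner_apply_eigenvectorBasis_self (hT : T.IsSymmetric) {d : ℕ} (hd : finrank ℝ V = d)
    (i : Fin d) :
    ⟪T (hT.eigenvectorBasis hd i), hT.eigenvectorBasis hd i⟫_ℝ = hT.eigenvalues hd i := by
  rw [hT.apply_eigenvectorBasis, real_inner_smul_left, real_inner_self_eq_norm_sq,
    (hT.eigenvectorBasis hd).orthonormal.1 i]
  simp only [RCLike.ofReal_real_eq_id, id_eq, one_pow, mul_one]

/-- **Ky Fan's inequality for two vectors.** For a symmetric operator on a real inner product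
space of dimension `m + 2` and every orthonormal pair `e₀, e₁`,
`μ (Fin.last (m+1)) + μ (Fin.last m).castSucc ≤ ⟪T e₀, e₀⟫ + ⟪T e₁, e₁⟫` (the two smallest
eigenvalues in Mathlib's antitone enumeration): expand in the eigenvector basis,
`Σⱼ ⟪T eⱼ, eⱼ⟫ = Σᵢ μᵢ cᵢ` with `cᵢ = Σⱼ ⟪bᵢ, eⱼ⟫² ∈ [0, 1]` (Bessel) and `Σᵢ cᵢ = 2` (Parseval).
[cite: HuiskenSinestrari2008, Prop. 2.6 (proof), p. 143] -/
theorem kyFan_two_le (hT : T.IsSymmetric) {m : ℕ} (hd : finrank ℝ V = m + 2)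
    {e : Fin 2 → V} (he : Orthonormal ℝ e) :
    hT.eigenvalues hd (Fin.last (m + 1)) + hT.eigenvalues hd (Fin.last m).castSucc ≤
      ∑ j, ⟪T (e j), e j⟫_ℝ := by
  set b := hT.eigenvectorBasis hd with hb
  set μ := hT.eigenvalues hd with hμ
  set c : Fin (m + 2) → ℝ := fun i => ∑ j, ⟪b i, e j⟫_ℝ ^ 2 with hc
  have hexp : ∑ j, ⟪T (e j), e j⟫_ℝ = ∑ i, μ i * c i := by
    simp_rw [inner_apply_self_eq_sum_eigenvalues hT hd, hc, Finset.mul_sum]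
    rw [Finset.sum_comm]
  have hcomm : ∀ i j, ⟪b i, e j⟫_ℝ = ⟪e j, b i⟫_ℝ := fun i j => real_inner_comm _ _
  have hc0 : ∀ i, 0 ≤ c i := fun i => Finset.sum_nonneg fun j _ => sq_nonneg _
  have hc1 : ∀ i, c i ≤ 1 := fun i => by
    have h := he.sum_inner_products_le (b i) (s := Finset.univ)
    have hbi : ‖b i‖ = 1 := b.orthonormal.1 i
    simp only [Real.norm_eq_abs, sq_abs, hbi, one_pow] at h
    show ∑ j, ⟪b i, e j⟫_ℝ ^ 2 ≤ 1
    simp_rw [hcomm]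
    exact h
  have hc2 : ∑ i, c i = 2 := by
    simp_rw [hc]
    rw [Finset.sum_comm]
    have hj : ∀ j, ∑ i, ⟪b i, e j⟫_ℝ ^ 2 = 1 := fun j => by
      have h := b.sum_inner_mul_inner (e j) (e j)
      rw [real_inner_self_eq_norm_sq, he.1 j, one_pow] at h
      simp_rw [hcomm] at h
      simp_rw [sq, hcomm]
      exact h
    simp [hj]
  rw [hexp]
  exact sum_mul_ge_two_smallest (hT.eigenvalues_antitone hd) hc0 hc1 hc2

/-- **The minimum is attained** by the pair of eigenvectors of the two smallest eigenvalues.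
[cite: HuiskenSinestrari2008, Prop. 2.6 (proof), p. 143] -/
theorem kyFan_two_attained (hT : T.IsSymmetric) {m : ℕ} (hd : finrank ℝ V = m + 2) :
    Orthonormal ℝ ![hT.eigenvectorBasis hd (Fin.last (m + 1)),
        hT.eigenvectorBasis hd (Fin.last m).castSucc] ∧
      ∑ j, ⟪T (![hT.eigenvectorBasis hd (Fin.last (m + 1)),
          hT.eigenvectorBasis hd (Fin.last m).castSucc] j),
        ![hT.eigenvectorBasis hd (Fin.last (m + 1)),
          hT.eigenvectorBasis hd (Fin.last m).castSucc] j⟫_ℝ =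
      hT.eigenvalues hd (Fin.last (m + 1)) + hT.eigenvalues hd (Fin.last m).castSucc := by
  set b := hT.eigenvectorBasis hd with hb
  set L : Fin (m + 2) := Fin.last (m + 1) with hL
  set P : Fin (m + 2) := (Fin.last m).castSucc with hP
  have hPL : P ≠ L := fun h => by
    have := congrArg Fin.val h
    simp [hP, hL] at this
  have hfun : ![b L, b P] = b ∘ ![L, P] := by
    funext j
    fin_cases j <;> rfl
  have hinj : Function.Injective ![L, P] := by
    intro i j hij
    fin_cases i <;> fin_cases j
    · rfl
    · exact absurd hij hPL.symm
    · exact absurd hij hPL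
    · rfl
  refine ⟨by rw [hfun]; exact b.orthonormal.comp _ hinj, ?_⟩
  rw [Fin.sum_univ_two]
  simp only [Matrix.cons_val_zero, Matrix.cons_val_one]
  rw [hb, inner_apply_eigenvectorBasis_self hT hd, inner_apply_eigenvectorBasis_self hT hd]

/-- **Ky Fan's minimum principle for `λ₁ + λ₂`, in the form used throughout the tree**: a
symmetric operator on a real inner product space of dimension `m + 2 ≥ 2` satisfies
"`⟪T e₀, e₀⟫ + ⟪T e₁, e₁⟫ ≥ c` for all orthonormal pairs" iff the sum of its two smallest
eigenvalues is `≥ c` (Huisken–Sinestrari, p. 143: "`λ₁ + λ₂ = min{W(e₁,e₁) + W(e₂,e₂) :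
|e₁| = |e₂| = 1, e₁ ⊥ e₂}`"). [cite: HuiskenSinestrari2008, Prop. 2.6 (proof), p. 143] -/
theorem kyFan_two_iff (hT : T.IsSymmetric) {m : ℕ} (hd : finrank ℝ V = m + 2) (c : ℝ) :
    (∀ e : Fin 2 → V, Orthonormal ℝ e → c ≤ ∑ j, ⟪T (e j), e j⟫_ℝ) ↔
      c ≤ hT.eigenvalues hd (Fin.last (m + 1)) + hT.eigenvalues hd (Fin.last m).castSucc := by
  constructor
  · intro h
    obtain ⟨horth, hsum⟩ := kyFan_two_attained hT hd
    rw [← hsum]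
    exact h _ horth
  · intro h e he
    exact h.trans (kyFan_two_le hT hd he)

/-- **"`λ₁ + λ₂` is a concave function of the operator"** (Huisken–Sinestrari, p. 143, the
sentence after the displayed identity: "being the infimum of a family of linear maps"): the sum
of the two smallest eigenvalues is superadditive, `λ₁₂(S + T) ≥ λ₁₂(S) + λ₁₂(T)`, and (trivially)
positively homogeneous — so `{λ₁ + λ₂ ≥ α₀ tr}` is a convex cone.
[cite: HuiskenSinestrari2008, Prop. 2.6 (proof), p. 143] -/
theorem kyFan_two_superadditive {S T : V →ₗ[ℝ] V} (hS : S.IsSymmetric) (hT : T.IsSymmetric)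
    {m : ℕ} (hd : finrank ℝ V = m + 2) :
    (hS.eigenvalues hd (Fin.last (m + 1)) + hS.eigenvalues hd (Fin.last m).castSucc) +
        (hT.eigenvalues hd (Fin.last (m + 1)) + hT.eigenvalues hd (Fin.last m).castSucc) ≤
      (hS.add hT).eigenvalues hd (Fin.last (m + 1)) +
        (hS.add hT).eigenvalues hd (Fin.last m).castSucc := by
  refine (kyFan_two_iff (hS.add hT) hd _).1 fun e he => ?_
  have h1 := kyFan_two_le hS hd he
  have h2 := kyFan_two_le hT hd he
  have hsum : ∑ j, ⟪(S + T) (e j), e j⟫_ℝ = ∑ j, ⟪S (e j), e j⟫_ℝ + ∑ j, ⟪T (e j), e j⟫_ℝ := by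
    rw [← Finset.sum_add_distrib]
    refine Finset.sum_congr rfl fun j _ => ?_
    rw [LinearMap.add_apply, inner_add_left]
  rw [hsum]
  linarith

/-! ### General `k`: the sum of the `k` smallest eigenvalues (Ky Fan 1949, Thm. 1;
Horn–Johnson Cor. 4.3.39; Harvey–Lawson, *p-convexity*, Cor. 2.6) -/

/-- The "last `k` indices" `{i : Fin d | d - k ≤ i}` are the image of `j ↦ d - k + j`,
`j : Fin k`. [folklore] -/
theorem filter_last_eq_image {d k : ℕ} (hk : k ≤ d) :
    (univ.filter fun i : Fin d => d - k ≤ (i : ℕ)) =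
      univ.image fun j : Fin k => (⟨d - k + j, by omega⟩ : Fin d) := by
  ext i
  simp only [mem_filter, mem_univ, true_and, mem_image]
  constructor
  · intro hi
    exact ⟨⟨(i : ℕ) - (d - k), by omega⟩, Fin.ext (by simp; omega)⟩
  · rintro ⟨j, rfl⟩
    simp

/-- Reindexing a sum over the last `k` indices. [folklore] -/
theorem sum_filter_last_eq {d k : ℕ} (hk : k ≤ d) (g : Fin d → ℝ) :
    ∑ i ∈ univ.filter (fun i : Fin d => d - k ≤ (i : ℕ)), g i =
      ∑ j : Fin k, g ⟨d - k + j, by omega⟩ := by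
  rw [filter_last_eq_image hk, Finset.sum_image]
  rintro j₁ - j₂ - h
  have := congrArg Fin.val h
  simp only at this
  exact Fin.ext (by omega)

/-- **Rearrangement bound behind Ky Fan's principle (general `k`).** For an antitone family
`μ : Fin d → ℝ` and weights `0 ≤ cᵢ ≤ 1` with `Σ cᵢ = k ≤ d`, `Σ μᵢ cᵢ` is at least the sum of
the `k` last (smallest) entries: with the pivot `μ* = μ_{d-k}`,
`Σ μᵢcᵢ - Σ_{i ≥ d-k} μᵢ = Σ_{i < d-k} μᵢ cᵢ + Σ_{i ≥ d-k} μᵢ (cᵢ - 1) ≥ μ* (Σ cᵢ - k) = 0`.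
[folklore] -/
theorem sum_mul_ge_sum_last {d k : ℕ} (hk : k ≤ d) {μ c : Fin d → ℝ} (hμ : Antitone μ)
    (hc0 : ∀ i, 0 ≤ c i) (hc1 : ∀ i, c i ≤ 1) (hck : ∑ i, c i = k) :
    ∑ i ∈ univ.filter (fun i : Fin d => d - k ≤ (i : ℕ)), μ i ≤ ∑ i, μ i * c i := by
  rcases Nat.eq_zero_or_pos k with rfl | hkpos
  · -- `k = 0`: all weights vanish
    have hc : ∀ i, c i = 0 := fun i =>
      le_antisymm (by
        have := Finset.single_le_sum (fun j _ => hc0 j) (mem_univ i)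
        rw [hck] at this; exact_mod_cast this) (hc0 i)
    rw [Finset.filter_false_of_mem (fun i _ => by rw [Nat.sub_zero, not_le]; exact i.is_lt),
      Finset.sum_empty]
    simp [hc]
  set S := univ.filter (fun i : Fin d => d - k ≤ (i : ℕ)) with hS
  set p : Fin d := ⟨d - k, by omega⟩ with hp
  have hcardS : S.card = k := by
    rw [hS, filter_last_eq_image hk, Finset.card_image_of_injective _ ?_, card_univ,
      Fintype.card_fin]
    intro j₁ j₂ h
    have := congrArg Fin.val h
    simp only at this
    exact Fin.ext (by omega)
  -- split `Σ μ c` along `S`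
  have hsplit : ∑ i, μ i * c i = ∑ i ∈ S, μ i * c i +
      ∑ i ∈ univ.filter (fun i : Fin d => ¬ d - k ≤ (i : ℕ)), μ i * c i :=
    (Finset.sum_filter_add_sum_filter_not _ _ _).symm
  have hsplitc : (k : ℝ) = ∑ i ∈ S, c i +
      ∑ i ∈ univ.filter (fun i : Fin d => ¬ d - k ≤ (i : ℕ)), c i := by
    rw [← hck]; exact (Finset.sum_filter_add_sum_filter_not _ _ _).symm
  -- bounds with the pivot `μ p`
  have h1 : ∑ i ∈ S, μ p * (c i - 1) ≤ ∑ i ∈ S, μ i * (c i - 1) := by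
    refine Finset.sum_le_sum fun i hi => ?_
    have hi' : d - k ≤ (i : ℕ) := (mem_filter.1 hi).2
    have hμi : μ i ≤ μ p := hμ (Fin.le_iff_val_le_val.2 (by simpa [hp] using hi'))
    exact mul_le_mul_of_nonpos_right hμi (by linarith [hc1 i])
  have h2 : ∑ i ∈ univ.filter (fun i : Fin d => ¬ d - k ≤ (i : ℕ)), μ p * c i ≤
      ∑ i ∈ univ.filter (fun i : Fin d => ¬ d - k ≤ (i : ℕ)), μ i * c i := by
    refine Finset.sum_le_sum fun i hi => ?_
    have hi' : ¬ d - k ≤ (i : ℕ) := (mem_filter.1 hi).2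
    have hμi : μ p ≤ μ i := hμ (Fin.le_iff_val_le_val.2 (by simp [hp]; omega))
    exact mul_le_mul_of_nonneg_right hμi (hc0 i)
  have hS1 : ∑ i ∈ S, μ i * (c i - 1) = ∑ i ∈ S, μ i * c i - ∑ i ∈ S, μ i := by
    rw [← Finset.sum_sub_distrib]; exact Finset.sum_congr rfl fun i _ => by ring
  have hS2 : ∑ i ∈ S, μ p * (c i - 1) = μ p * (∑ i ∈ S, c i - k) := by
    rw [← Finset.mul_sum, Finset.sum_sub_distrib, Finset.sum_const, hcardS]; simp
  have h3 : ∑ i ∈ univ.filter (fun i : Fin d => ¬ d - k ≤ (i : ℕ)), c i =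
      k - ∑ i ∈ S, c i := by
    linarith
  rw [← Finset.mul_sum, h3] at h2
  rw [hS2] at h1
  rw [hsplit]
  linarith [h1, h2, hS1]

/-- **Ky Fan's inequality for `k`-frames.** For a symmetric operator on a real inner product
space of dimension `d` and every orthonormal `k`-frame `e` (`k ≤ d`), the sum
`Σⱼ ⟪T eⱼ, eⱼ⟫` is at least the sum of the `k` smallest eigenvalues (the last `k` in Mathlib's
antitone enumeration). [folklore] -/
theorem kyFan_le (hT : T.IsSymmetric) {d : ℕ} (hd : finrank ℝ V = d) {k : ℕ} (hk : k ≤ d)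
    {e : Fin k → V} (he : Orthonormal ℝ e) :
    ∑ i ∈ univ.filter (fun i : Fin d => d - k ≤ (i : ℕ)), hT.eigenvalues hd i ≤
      ∑ j, ⟪T (e j), e j⟫_ℝ := by
  set b := hT.eigenvectorBasis hd with hb
  set μ := hT.eigenvalues hd with hμ
  set c : Fin d → ℝ := fun i => ∑ j, ⟪b i, e j⟫_ℝ ^ 2 with hc
  have hexp : ∑ j, ⟪T (e j), e j⟫_ℝ = ∑ i, μ i * c i := by
    simp_rw [inner_apply_self_eq_sum_eigenvalues hT hd, hc, Finset.mul_sum]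
    rw [Finset.sum_comm]
  have hcomm : ∀ i j, ⟪b i, e j⟫_ℝ = ⟪e j, b i⟫_ℝ := fun i j => real_inner_comm _ _
  have hc0 : ∀ i, 0 ≤ c i := fun i => Finset.sum_nonneg fun j _ => sq_nonneg _
  have hc1 : ∀ i, c i ≤ 1 := fun i => by
    have h := he.sum_inner_products_le (b i) (s := Finset.univ)
    have hbi : ‖b i‖ = 1 := b.orthonormal.1 i
    simp only [Real.norm_eq_abs, sq_abs, hbi, one_pow] at h
    show ∑ j, ⟪b i, e j⟫_ℝ ^ 2 ≤ 1
    simp_rw [hcomm]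
    exact h
  have hck : ∑ i, c i = k := by
    simp_rw [hc]
    rw [Finset.sum_comm]
    have hj : ∀ j, ∑ i, ⟪b i, e j⟫_ℝ ^ 2 = 1 := fun j => by
      have h := b.sum_inner_mul_inner (e j) (e j)
      rw [real_inner_self_eq_norm_sq, he.1 j, one_pow] at h
      simp_rw [hcomm] at h
      simp_rw [sq, hcomm]
      exact h
    simp [hj]
  rw [hexp]
  exact sum_mul_ge_sum_last hk (hT.eigenvalues_antitone hd) hc0 hc1 hck

/-- **The minimum is attained** by the frame of the last `k` eigenvectors. [folklore] -/
theorem kyFan_attained (hT : T.IsSymmetric) {d : ℕ} (hd : finrank ℝ V = d) {k : ℕ} (hk : k ≤ d) :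
    Orthonormal ℝ (fun j : Fin k => hT.eigenvectorBasis hd ⟨d - k + j, by omega⟩) ∧
      ∑ j : Fin k, ⟪T (hT.eigenvectorBasis hd ⟨d - k + j, by omega⟩),
          hT.eigenvectorBasis hd ⟨d - k + j, by omega⟩⟫_ℝ =
        ∑ i ∈ univ.filter (fun i : Fin d => d - k ≤ (i : ℕ)), hT.eigenvalues hd i := by
  have hinj : Function.Injective fun j : Fin k => (⟨d - k + j, by omega⟩ : Fin d) := by
    intro j₁ j₂ h
    have := congrArg Fin.val h
    simp only at this
    exact Fin.ext (by omega)
  refine ⟨(hT.eigenvectorBasis hd).orthonormal.comp _ hinj, ?_⟩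
  rw [sum_filter_last_eq hk]
  exact Finset.sum_congr rfl fun j _ => inner_apply_eigenvectorBasis_self hT hd _

/-- **Ky Fan's minimum principle (general `k`), in the form used throughout the tree**:
"`Σⱼ ⟪T eⱼ, eⱼ⟫ ≥ c` for all orthonormal `k`-frames" iff the `k` smallest eigenvalues sum to
`≥ c` — the eigenvalue reading of the trace-over-frames conditions (`k`-convexity
`IsKConvexLevelSetAt k`, Harvey–Lawson Cor. 2.6; `k = 2`: two-convexity, 2-positive curvature
operator). [folklore] -/
theorem kyFan_iff (hT : T.IsSymmetric) {d : ℕ} (hd : finrank ℝ V = d) {k : ℕ} (hk : k ≤ d)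
    (c : ℝ) :
    (∀ e : Fin k → V, Orthonormal ℝ e → c ≤ ∑ j, ⟪T (e j), e j⟫_ℝ) ↔
      c ≤ ∑ i ∈ univ.filter (fun i : Fin d => d - k ≤ (i : ℕ)), hT.eigenvalues hd i := by
  constructor
  · intro h
    obtain ⟨horth, hsum⟩ := kyFan_attained hT hd hk
    rw [← hsum]
    exact h _ horth
  · intro h e he
    exact h.trans (kyFan_le hT hd hk he)

/-- Strict form of `kyFan_iff`: "`Σⱼ ⟪T eⱼ, eⱼ⟫ > c` for all orthonormal `k`-frames" iff the
`k` smallest eigenvalues sum to `> c` (e.g. strict `k`-convexity `IsKConvexLevelSetAt k`,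
`λ₁ + ⋯ + λ_k > 0`). [folklore] -/
theorem kyFan_lt_iff (hT : T.IsSymmetric) {d : ℕ} (hd : finrank ℝ V = d) {k : ℕ} (hk : k ≤ d)
    (c : ℝ) :
    (∀ e : Fin k → V, Orthonormal ℝ e → c < ∑ j, ⟪T (e j), e j⟫_ℝ) ↔
      c < ∑ i ∈ univ.filter (fun i : Fin d => d - k ≤ (i : ℕ)), hT.eigenvalues hd i := by
  constructor
  · intro h
    obtain ⟨horth, hsum⟩ := kyFan_attained hT hd hk
    rw [← hsum]
    exact h _ horth
  · intro h e he
    exact h.trans_le (kyFan_le hT hd hk he)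

end Literature.Analysis.InnerProduct

end
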